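import Summits.HubbardSuperconductivity.HubbardSuperconductivity.Theses.WidthHaldane

/-!
# Strategist census sketch for crux `WidthHaldaneBridge` (stmt-HubbardSuperconductivity-16311)

Planner `planner-cstrat-stmt-HubbardSuperconductivity-16311-s1-0`, 2026-08-17 (crux-strategist). NOT a registered
line: this file types the alternative cuts / strengthenings / negation-obstruction discussed in
`STRATEGY-CENSUS.md` over the crux's own vocabulary and kernel-checks the compositions, so that
every census heading carries a concrete, elaborated attempt. Sorries: none (statements that are
conjecture-strength are `def … : Prop`, never asserted).

* `UniformThermo`, `LawAtLM`, `LawAt` — verbatim slices of the crux (same `let`-prefix as the route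
  decl and as `Lines/birth.lean`), `LawAt` re-expressed through the one-(L,M) law `LawAtLM`.
* `BridgeFamily` ↔ the crux (`bridge_of_family`, `family_of_bridge`).
* DECOMPOSITION (length climb, dual to birth's width climb): `SquareBlocksCohere` (J1, aspect
  ratio ≤ 2, uniform constants) ∧ `LengthClimb` (J2) → crux (`bridge_of_blocks`); J1 is a
  consequence of the crux (`squareBlocksCohere_of_family`) and already contains the diagonal law
  (`diagonal_of_squareBlocks`) — the only instance `WidthHaldane.closes` consumes.
* STRENGTHEN: `TwoSidedLawLM` (asymptotic rigidity S⁺₁); spin-gap insertion S⁺₂ =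
  `StiffImpliesSpinGap` ∧ `LutherEmeryUniversality` → crux (`bridge_of_spinGap`).
* NEGATION: `NoFixedWidthLRO` (Pitaevskii–Stringari / Koma–Tasaki-type tightness, signature) —
  the obstruction met when trying to push the exponent to 0 at fixed width.
-/

namespace Summit.HubbardSuperconductivity.HubbardSuperconductivity.Cruxes.WidthHaldaneBridge.Strategist

open scoped BigOperators Matrix ComplexConjugate
open Literature.Hubbard
open Summit.HubbardSuperconductivity.HubbardSuperconductivity.Theses.WidthHaldane (WidthHaldaneBridge)

/-- The crux's HYPOTHESIS (verbatim slice, as in `Lines/birth.lean`). -/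
def UniformThermo (U δ d₀ k₀ : ℝ) (M₁ L₀ : ℕ) : Prop :=
  open Matrix Literature.MathematicalPhysics.QuantumLattice in let H0 : ∀ (L M : ℕ) (Λ : Type) [LinearOrder Λ] [Fintype Λ], (Λ ≃ ZMod L × ZMod M) → ℝ → Matrix (Finset (Orb Λ)) (Finset (Orb Λ)) ℂ := fun _ _ Λ _ _ e U => hamiltonian (SimpleGraph.fromRel fun x y : Λ => y = e.symm ((e x).1 + 1, (e x).2) ∨ y = e.symm ((e x).1, (e x).2 + 1)) 1 U; let Tw : ∀ (L M : ℕ) [NeZero L] [NeZero M] (Λ : Type) [LinearOrder Λ] [Fintype Λ], (Λ ≃ ZMod L × ZMod M) → ℝ → Matrix (Finset (Orb Λ)) (Finset (Orb Λ)) ℂ := fun _ M _ _ _ _ _ e θ => ∑ b : ZMod M, ∑ σ : Fin 2, ((1 - Complex.exp (Complex.I * θ)) • (creation (orb (e.symm (0, b)) σ) * annihilation (orb (e.symm (-1, b)) σ)) + (1 - Complex.exp (-(Complex.I * θ))) • (creation (orb (e.symm (-1, b)) σ) * annihilation (orb (e.symm (0, b)) σ))); let E : ∀ (L M : ℕ)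 [NeZero L] [NeZero M] (Λ : Type) [LinearOrder Λ] [Fintype Λ], (Λ ≃ ZMod L × ZMod M) → ℝ → ℝ → ℕ → ℝ := fun L M _ _ Λ _ _ e U θ N => (H0 L M Λ e U + Tw L M Λ e θ).minEnergyOn (szSector N 0); let Np : ℕ → ℕ → ℝ → ℕ := fun L M δ => 2 * ⌊(1 - δ) * ((L : ℝ) * (M : ℝ)) / 2⌋₊; let stiff : ∀ (L M : ℕ) [NeZero L] [NeZero M] (Λ : Type) [LinearOrder Λ] [Fintype Λ], (Λ ≃ ZMod L × ZMod M) → ℝ → ℝ → ℝ := fun L M _ _ Λ _ _ e U δ => 2 * (L : ℝ) * (E L M Λ e U (Real.pi / 3) (Np L M δ) - E L M Λ e U 0 (Np L M δ)) / ((Real.pi / 3) ^ 2 * (M : ℝ)); let icomp : ∀ (L M : ℕ) [NeZero L] [NeZero M] (Λ : Type) [LinearOrder Λ] [Fintype Λ], (Λ ≃ ZMod L × ZMod M) → ℝ → ℝ → ℝ := fun L M _ _ Λ _ _ e U δ => (L : ℝ) * (M : ℝ) * (E L M Λ e U 0 (Np L M δ + 2) + E L M Λ e U 0 (Np L M δ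 - 2) - 2 * E L M Λ e U 0 (Np L M δ)) / 4; ∀ (L M : ℕ) [NeZero L] [NeZero M], Even L → Even M → M₁ ≤ M → M ≤ L → L₀ ≤ L → ∀ (Λ : Type) [LinearOrder Λ] [Fintype Λ] (e : Λ ≃ ZMod L × ZMod M), d₀ ≤ stiff L M Λ e U δ ∧ 0 < icomp L M Λ e U δ ∧ icomp L M Λ e U δ ≤ k₀

/-- The Haldane-form column-pair law at ONE pair `(L, M)` with constants `(Ξ, A, R)` (verbatim slice of the crux's conclusion). -/
def LawAtLM (U δ : ℝ) (L M : ℕ) [NeZero L] [NeZero M] (Ξ A : ℝ) (R : ℕ) : Prop :=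
  open Matrix Literature.MathematicalPhysics.QuantumLattice in let H0 : ∀ (L M : ℕ) (Λ : Type) [LinearOrder Λ] [Fintype Λ], (Λ ≃ ZMod L × ZMod M) → ℝ → Matrix (Finset (Orb Λ)) (Finset (Orb Λ)) ℂ := fun _ _ Λ _ _ e U => hamiltonian (SimpleGraph.fromRel fun x y : Λ => y = e.symm ((e x).1 + 1, (e x).2) ∨ y = e.symm ((e x).1, (e x).2 + 1)) 1 U; let Tw : ∀ (L M : ℕ) [NeZero L] [NeZero M] (Λ : Type) [LinearOrder Λ] [Fintype Λ], (Λ ≃ ZMod L × ZMod M) → ℝ → Matrix (Finset (Orb Λ)) (Finset (Orb Λ)) ℂ := fun _ M _ _ _ _ _ e θ => ∑ b : ZMod M, ∑ σ : Fin 2, ((1 - Complex.exp (Complex.I * θ)) • (creation (orb (e.symm (0, b)) σ) * annihilation (orb (e.symm (-1, b)) σ)) + (1 - Complex.exp (-(Complex.I * θ))) • (creation (orb (e.symm (-1, b)) σ) * annihilation (orb (e.symm (0, b)) σ))); let E : ∀ (L M : ℕ) [NeZero L] [NeZero M] (Λ : Type) [LinearOrder Λ] [Fintype Λ], (Λ ≃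 ZMod L × ZMod M) → ℝ → ℝ → ℕ → ℝ := fun L M _ _ Λ _ _ e U θ N => (H0 L M Λ e U + Tw L M Λ e θ).minEnergyOn (szSector N 0); let Np : ℕ → ℕ → ℝ → ℕ := fun L M δ => 2 * ⌊(1 - δ) * ((L : ℝ) * (M : ℝ)) / 2⌋₊; let stiff : ∀ (L M : ℕ) [NeZero L] [NeZero M] (Λ : Type) [LinearOrder Λ] [Fintype Λ], (Λ ≃ ZMod L × ZMod M) → ℝ → ℝ → ℝ := fun L M _ _ Λ _ _ e U δ => 2 * (L : ℝ) * (E L M Λ e U (Real.pi / 3) (Np L M δ) - E L M Λ e U 0 (Np L M δ)) / ((Real.pi / 3) ^ 2 * (M : ℝ)); let icomp : ∀ (L M : ℕ) [NeZero L] [NeZero M] (Λ : Type) [LinearOrder Λ] [Fintype Λ], (Λ ≃ ZMod L × ZMod M) → ℝ → ℝ → ℝ := fun L M _ _ Λ _ _ e U δ => (L : ℝ) * (M : ℝ) * (E L M Λ e U 0 (Np L M δ + 2) + E L M Λ e U 0 (Np L M δ - 2) - 2 * E L M Λ e U 0 (Np L M δ)) / 4; let P : ∀ (L M : ℕ) (Λ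 : Type) [LinearOrder Λ] [Fintype Λ], (Λ ≃ ZMod L × ZMod M) → Λ → Matrix (Finset (Orb Λ)) (Finset (Orb Λ)) ℂ := fun _ _ Λ _ _ e x => ∑ j : Fin 4, (((![1, 1, -1, -1] : Fin 4 → ℝ) j / Real.sqrt 2 : ℝ) : ℂ) • (annihilation (orb x 0) * annihilation (orb ((![e.symm ((e x).1 + 1, (e x).2), e.symm ((e x).1 - 1, (e x).2), e.symm ((e x).1, (e x).2 + 1), e.symm ((e x).1, (e x).2 - 1)] : Fin 4 → Λ) j) 1) - annihilation (orb x 1) * annihilation (orb ((![e.symm ((e x).1 + 1, (e x).2), e.symm ((e x).1 - 1, (e x).2), e.symm ((e x).1, (e x).2 + 1), e.symm ((e x).1, (e x).2 - 1)] : Fin 4 → Λ) j) 0)); let G : ∀ (L M : ℕ) [NeZero L] [NeZero M] (Λ : Type) [LinearOrder Λ] [Fintype Λ], (Λ ≃ ZMod L × ZMod M) → Fock (Orb Λ) → ZMod L → ℝ := fun L M _ _ Λ _ _ e ψ r => ∑ a : ZMod L, (expect ((∑ b : ZMod M, P L M Λ e (e.symm (a, b)))ᴴ * (∑ b : ZMod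 M, P L M Λ e (e.symm (a + r, b)))) ψ).re; ∀ (Λ : Type) [LinearOrder Λ] [Fintype Λ] (e : Λ ≃ ZMod L × ZMod M), ∀ ψ : Fock (Orb Λ), star ψ ⬝ᵥ ψ = 1 → IsGroundStateInSector (H0 L M Λ e U) (Np L M δ) 0 ψ → ∀ r : ZMod L, R ≤ r.val → r.val + R ≤ L → A * (L : ℝ) * (M : ℝ) ^ 2 * ((min r.val (L - r.val) : ℕ) : ℝ) ^ (-(Ξ * Real.sqrt (icomp L M Λ e U δ / stiff L M Λ e U δ) / (M : ℝ))) ≤ G L M Λ e ψ r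

/-- `Lines/birth.lean`'s `LawAt` (law at width `M` for all even `L ≥ max(M, L₁)`), through `LawAtLM`. -/
def LawAt (U δ : ℝ) (M : ℕ) (Ξ A : ℝ) (R L₁ : ℕ) : Prop :=
  ∀ (L : ℕ) [NeZero L] [NeZero M], Even L → M ≤ L → L₁ ≤ L → LawAtLM U δ L M Ξ A R

/-- The law at width `M` restricted to aspect ratios `L ≤ c·M` (near-square tubes for `c = 2`). -/
def LawAtAspect (U δ : ℝ) (M : ℕ) (Ξ A : ℝ) (R L₁ c : ℕ) : Prop :=
  ∀ (L : ℕ) [NeZero L] [NeZero M], Even L → M ≤ L → L ≤ c * M → L₁ ≤ L → LawAtLM U δ L M Ξ A R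

/-- The crux in family form: uniform thermodynamics ⇒ ONE law with width-uniform constants for all even widths beyond a floor. -/
def BridgeFamily : Prop :=
  ∀ U : ℝ, 0 < U → ∀ δ ∈ Set.Ioo (0 : ℝ) (3 / 10), ∀ (d₀ k₀ : ℝ) (M₁ L₀ : ℕ), 0 < d₀ →
    UniformThermo U δ d₀ k₀ M₁ L₀ →
      ∃ Ξ : ℝ, 0 < Ξ ∧ ∃ A : ℝ, 0 < A ∧ ∃ R M₂ L₁ : ℕ, ∀ M : ℕ, Even M → M₂ ≤ M → LawAt U δ M Ξ A R L₁

/-- Family form ⇒ the route decl, by `ζ/δ`-unfolding and binder shuffling only. -/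
theorem bridge_of_family (h : BridgeFamily) : WidthHaldaneBridge := by
  dsimp only [BridgeFamily, UniformThermo, LawAt, LawAtLM] at h
  dsimp only [WidthHaldaneBridge]
  intro U hU δ hδ d₀ k₀ M₁ L₀ hd₀ hth
  obtain ⟨Ξ, hΞ, A, hA, R, M₂, L₁, hlaw⟩ := h U hU δ hδ d₀ k₀ M₁ L₀ hd₀ hth
  refine ⟨Ξ, hΞ, A, hA, R, M₂, L₁, ?_⟩
  intro L M _ _ hLe hMe hM hML hL Λ _ _ e ψ hψ hGS r hr hrL
  exact hlaw M hMe hM L hLe hML hL Λ e ψ hψ hGS r hr hrL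

/-- … and conversely: the family form IS the crux. -/
theorem family_of_bridge (h : WidthHaldaneBridge) : BridgeFamily := by
  dsimp only [WidthHaldaneBridge] at h
  dsimp only [BridgeFamily, UniformThermo, LawAt, LawAtLM]
  intro U hU δ hδ d₀ k₀ M₁ L₀ hd₀ hth
  obtain ⟨Ξ, hΞ, A, hA, R, M₂, L₁, hlaw⟩ := h U hU δ hδ d₀ k₀ M₁ L₀ hd₀ hth
  refine ⟨Ξ, hΞ, A, hA, R, M₂, L₁, ?_⟩
  intro M hMe hM L _ _ hLe hML hL Λ _ _ e ψ hψ hGS r hr hrL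
  exact hlaw L M hLe hMe hM hML hL Λ e ψ hψ hGS r hr hrL

/-! ## DECOMPOSITION attempt: the length climb (dual to `birth`'s width climb) -/

/-- J1 — SQUARE BLOCKS COHERE: under uniform thermodynamics, every NEAR-SQUARE tube (`M ≤ L ≤ 2M`) obeys the law with
width-uniform constants (there `r̂ ≤ L/2 ≤ M`, so `r̂^{−Ξ√(k₀/d₀)/M} ≥ M^{−C/M} → 1`: this is an LRO-amplitude statement,
the 2D content — 'stiff, compressible squares have `d_{x²−y²}` column coherence'). -/
def SquareBlocksCohere : Prop :=
  ∀ U : ℝ, 0 < U → ∀ δ ∈ Set.Ioo (0 : ℝ) (3 / 10), ∀ (d₀ k₀ : ℝ) (M₁ L₀ : ℕ), 0 < d₀ →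
    UniformThermo U δ d₀ k₀ M₁ L₀ →
      ∃ Ξ : ℝ, 0 < Ξ ∧ ∃ A : ℝ, 0 < A ∧ ∃ R M₂ L₁ : ℕ, ∀ M : ℕ, Even M → M₂ ≤ M → LawAtAspect U δ M Ξ A R L₁ 2

/-- J2 — LENGTH CLIMB (the quasi-1D / Kosterlitz–Thouless content): under uniform thermodynamics, IF all near-square tubes
of all widths `≥ M₂` obey the law with common constants THEN all tubes of every aspect ratio obey it (with other uniform
constants): a long tube is a Josephson chain of `L/M` coherent square blocks with charging energy `4ẽ″/M²` and coupling
`∝ ρ̃`, i.e. a quantum-rotor chain of Luttinger number `K ∝ M√(ρ̃/ẽ″) = K̂` deep in its power-law phase. -/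
def LengthClimb : Prop :=
  ∀ U : ℝ, 0 < U → ∀ δ ∈ Set.Ioo (0 : ℝ) (3 / 10), ∀ (d₀ k₀ : ℝ) (M₁ L₀ : ℕ), 0 < d₀ →
    UniformThermo U δ d₀ k₀ M₁ L₀ →
      ∀ (Ξ A : ℝ) (R M₂ L₁ : ℕ), 0 < Ξ → 0 < A →
        (∀ M : ℕ, Even M → M₂ ≤ M → LawAtAspect U δ M Ξ A R L₁ 2) →
          ∃ Ξ' : ℝ, 0 < Ξ' ∧ ∃ A' : ℝ, 0 < A' ∧ ∃ R' M₂' L₁' : ℕ, ∀ M : ℕ, Even M → M₂' ≤ M → LawAt U δ M Ξ' A' R' L₁'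

/-- The length-climb cut composes to the crux (kernel-checked; the join is modus ponens). -/
theorem family_of_blocks (h1 : SquareBlocksCohere) (h2 : LengthClimb) : BridgeFamily := by
  intro U hU δ hδ d₀ k₀ M₁ L₀ hd₀ hth
  obtain ⟨Ξ, hΞ, A, hA, R, M₂, L₁, hsq⟩ := h1 U hU δ hδ d₀ k₀ M₁ L₀ hd₀ hth
  exact h2 U hU δ hδ d₀ k₀ M₁ L₀ hd₀ hth Ξ A R M₂ L₁ hΞ hA hsq

theorem bridge_of_blocks (h1 : SquareBlocksCohere) (h2 : LengthClimb) : WidthHaldaneBridge :=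
  bridge_of_family (family_of_blocks h1 h2)

/-- J1 is a CONSEQUENCE of the crux (restriction to aspect ratio ≤ 2): it is strictly inside the crux, not a costume of it. -/
theorem squareBlocksCohere_of_family (h : BridgeFamily) : SquareBlocksCohere := by
  intro U hU δ hδ d₀ k₀ M₁ L₀ hd₀ hth
  obtain ⟨Ξ, hΞ, A, hA, R, M₂, L₁, hlaw⟩ := h U hU δ hδ d₀ k₀ M₁ L₀ hd₀ hth
  exact ⟨Ξ, hΞ, A, hA, R, M₂, L₁, fun M hMe hM L _ _ hLe hML _ hL => hlaw M hMe hM L hLe hML hL⟩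

/-- The DIAGONAL law (M = L): the only instance of the crux's conclusion that `WidthHaldane.closes` consumes. -/
def DiagonalLaw : Prop :=
  ∀ U : ℝ, 0 < U → ∀ δ ∈ Set.Ioo (0 : ℝ) (3 / 10), ∀ (d₀ k₀ : ℝ) (M₁ L₀ : ℕ), 0 < d₀ →
    UniformThermo U δ d₀ k₀ M₁ L₀ →
      ∃ Ξ : ℝ, 0 < Ξ ∧ ∃ A : ℝ, 0 < A ∧ ∃ R L₁ : ℕ, ∀ (L : ℕ) [NeZero L], Even L → L₁ ≤ L → LawAtLM U δ L L Ξ A R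

/-- J1 already contains the diagonal. -/
theorem diagonal_of_squareBlocks (h : SquareBlocksCohere) : DiagonalLaw := by
  intro U hU δ hδ d₀ k₀ M₁ L₀ hd₀ hth
  obtain ⟨Ξ, hΞ, A, hA, R, M₂, L₁, hsq⟩ := h U hU δ hδ d₀ k₀ M₁ L₀ hd₀ hth
  refine ⟨Ξ, hΞ, A, hA, R, max M₂ L₁, fun L _ hLe hL => ?_⟩
  exact hsq L hLe (le_of_max_le_left hL) L hLe le_rfl (by omega) (le_of_max_le_right hL)

/-! ## STRENGTHEN attempts -/

/-- S⁺₁ — TWO-SIDED Haldane law at one `(L, M)` (asymptotic rigidity: the column pair correlation IS a power law with the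
thermodynamic exponent, up to constants). Signature only. -/
def TwoSidedLawLM (U δ : ℝ) (L M : ℕ) [NeZero L] [NeZero M] (Ξ Ξ' A B : ℝ) (R : ℕ) : Prop :=
  open Matrix Literature.MathematicalPhysics.QuantumLattice in let H0 : ∀ (L M : ℕ) (Λ : Type) [LinearOrder Λ] [Fintype Λ], (Λ ≃ ZMod L × ZMod M) → ℝ → Matrix (Finset (Orb Λ)) (Finset (Orb Λ)) ℂ := fun _ _ Λ _ _ e U => hamiltonian (SimpleGraph.fromRel fun x y : Λ => y = e.symm ((e x).1 + 1, (e x).2) ∨ y = e.symm ((e x).1, (e x).2 + 1)) 1 U; let Tw : ∀ (L M : ℕ) [NeZero L] [NeZero M] (Λ : Type) [LinearOrder Λ] [Fintype Λ], (Λ ≃ ZMod L × ZMod M) → ℝ → Matrix (Finset (Orb Λ)) (Finset (Orb Λ)) ℂ := fun _ M _ _ _ _ _ e θ => ∑ b : ZMod M, ∑ σ : Fin 2, ((1 - Complex.exp (Complex.I * θ)) • (creation (orb (e.symm (0, b)) σ) * annihilation (orb (e.symm (-1, b)) σ)) + (1 - Complex.exp (-(Complex.I * θ))) • (creation (orb (e.symm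 (-1, b)) σ) * annihilation (orb (e.symm (0, b)) σ))); let E : ∀ (L M : ℕ) [NeZero L] [NeZero M] (Λ : Type) [LinearOrder Λ] [Fintype Λ], (Λ ≃ ZMod L × ZMod M) → ℝ → ℝ → ℕ → ℝ := fun L M _ _ Λ _ _ e U θ N => (H0 L M Λ e U + Tw L M Λ e θ).minEnergyOn (szSector N 0); let Np : ℕ → ℕ → ℝ → ℕ := fun L M δ => 2 * ⌊(1 - δ) * ((L : ℝ) * (M : ℝ)) / 2⌋₊; let stiff : ∀ (L M : ℕ) [NeZero L] [NeZero M] (Λ : Type) [LinearOrder Λ] [Fintype Λ], (Λ ≃ ZMod L × ZMod M) → ℝ → ℝ → ℝ := fun L M _ _ Λ _ _ e U δ => 2 * (L : ℝ) * (E L M Λ e U (Real.pi / 3) (Np L M δ) - E L M Λ e U 0 (Np L M δ)) / ((Real.pi / 3) ^ 2 * (M : ℝ)); let icomp : ∀ (L M : ℕ) [NeZero L] [NeZero M] (Λ : Type) [LinearOrder Λ] [Fintype Λ], (Λ ≃ ZMod L × ZMod M) → ℝ → ℝ → ℝ := fun L M _ _ Λ _ _ e U δ => (L : ℝ) * (M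 : ℝ) * (E L M Λ e U 0 (Np L M δ + 2) + E L M Λ e U 0 (Np L M δ - 2) - 2 * E L M Λ e U 0 (Np L M δ)) / 4; let P : ∀ (L M : ℕ) (Λ : Type) [LinearOrder Λ] [Fintype Λ], (Λ ≃ ZMod L × ZMod M) → Λ → Matrix (Finset (Orb Λ)) (Finset (Orb Λ)) ℂ := fun _ _ Λ _ _ e x => ∑ j : Fin 4, (((![1, 1, -1, -1] : Fin 4 → ℝ) j / Real.sqrt 2 : ℝ) : ℂ) • (annihilation (orb x 0) * annihilation (orb ((![e.symm ((e x).1 + 1, (e x).2), e.symm ((e x).1 - 1, (e x).2), e.symm ((e x).1, (e x).2 + 1), e.symm ((e x).1, (e x).2 - 1)] : Fin 4 → Λ) j) 1) - annihilation (orb x 1) * annihilation (orb ((![e.symm ((e x).1 + 1, (e x).2), e.symm ((e x).1 - 1, (e x).2), e.symm ((e x).1, (e x).2 + 1), e.symm ((e x).1, (e x).2 - 1)] : Fin 4 → Λ) j) 0)); let G : ∀ (L M : ℕ) [NeZero L] [NeZero M] (Λ : Type) [LinearOrder Λ] [Fintype Λ], (Λ ≃ ZMod L × ZMod M) → Fock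 (Orb Λ) → ZMod L → ℝ := fun L M _ _ Λ _ _ e ψ r => ∑ a : ZMod L, (expect ((∑ b : ZMod M, P L M Λ e (e.symm (a, b)))ᴴ * (∑ b : ZMod M, P L M Λ e (e.symm (a + r, b)))) ψ).re; ∀ (Λ : Type) [LinearOrder Λ] [Fintype Λ] (e : Λ ≃ ZMod L × ZMod M), ∀ ψ : Fock (Orb Λ), star ψ ⬝ᵥ ψ = 1 → IsGroundStateInSector (H0 L M Λ e U) (Np L M δ) 0 ψ → ∀ r : ZMod L, R ≤ r.val → r.val + R ≤ L → A * (L : ℝ) * (M : ℝ) ^ 2 * ((min r.val (L - r.val) : ℕ) : ℝ) ^ (-(Ξ * Real.sqrt (icomp L M Λ e U δ / stiff L M Λ e U δ) / (M : ℝ))) ≤ G L M Λ e ψ r ∧ G L M Λ e ψ r ≤ B * (L : ℝ) * (M : ℝ) ^ 2 * ((min r.val (L - r.val) : ℕ) : ℝ) ^ (-(Ξ' * Real.sqrt (icomp L M Λ e U δ / stiff L M Λ e U δ) / (M : ℝ)))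

/-- Spin gap `≥ g/M` of the width-`M` tube at one `(L, M)`: sector minimum at `S^z = 1` minus sector minimum at `S^z = 0`
(same particle number). -/
def SpinGapLM (U δ : ℝ) (L M : ℕ) [NeZero L] [NeZero M] (g : ℝ) : Prop :=
  open Matrix Literature.MathematicalPhysics.QuantumLattice in let H0 : ∀ (L M : ℕ) (Λ : Type) [LinearOrder Λ] [Fintype Λ], (Λ ≃ ZMod L × ZMod M) → ℝ → Matrix (Finset (Orb Λ)) (Finset (Orb Λ)) ℂ := fun _ _ Λ _ _ e U => hamiltonian (SimpleGraph.fromRel fun x y : Λ => y = e.symm ((e x).1 + 1, (e x).2) ∨ y = e.symm ((e x).1, (e x).2 + 1)) 1 U; let Tw : ∀ (L M : ℕ) [NeZero L] [NeZero M] (Λ : Type) [LinearOrder Λ] [Fintype Λ], (Λ ≃ ZMod L × ZMod M) → ℝ → Matrix (Finset (Orb Λ)) (Finset (Orb Λ)) ℂ := fun _ M _ _ _ _ _ e θ => ∑ b : ZMod M, ∑ σ : Fin 2, ((1 - Complex.exp (Complex.I * θ)) • (creation (orb (e.symm (0, b)) σ) * annihilation (orb (e.symm (-1, b)) σ)) +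 (1 - Complex.exp (-(Complex.I * θ))) • (creation (orb (e.symm (-1, b)) σ) * annihilation (orb (e.symm (0, b)) σ))); let E : ∀ (L M : ℕ) [NeZero L] [NeZero M] (Λ : Type) [LinearOrder Λ] [Fintype Λ], (Λ ≃ ZMod L × ZMod M) → ℝ → ℝ → ℕ → ℝ := fun L M _ _ Λ _ _ e U θ N => (H0 L M Λ e U + Tw L M Λ e θ).minEnergyOn (szSector N 0); let Np : ℕ → ℕ → ℝ → ℕ := fun L M δ => 2 * ⌊(1 - δ) * ((L : ℝ) * (M : ℝ)) / 2⌋₊; let stiff : ∀ (L M : ℕ) [NeZero L] [NeZero M] (Λ : Type) [LinearOrder Λ] [Fintype Λ], (Λ ≃ ZMod L × ZMod M) → ℝ → ℝ → ℝ := fun L M _ _ Λ _ _ e U δ => 2 * (L : ℝ) * (E L M Λ e U (Real.pi / 3) (Np L M δ) - E L M Λ e U 0 (Np L M δ)) / ((Real.pi / 3) ^ 2 * (M : ℝ)); let icomp : ∀ (L M : ℕ) [NeZero L] [NeZero M] (Λ : Type) [LinearOrder Λ] [Fintype Λ], (Λ ≃ ZMod L × ZMod M) → ℝ → ℝ → ℝ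 := fun L M _ _ Λ _ _ e U δ => (L : ℝ) * (M : ℝ) * (E L M Λ e U 0 (Np L M δ + 2) + E L M Λ e U 0 (Np L M δ - 2) - 2 * E L M Λ e U 0 (Np L M δ)) / 4; let P : ∀ (L M : ℕ) (Λ : Type) [LinearOrder Λ] [Fintype Λ], (Λ ≃ ZMod L × ZMod M) → Λ → Matrix (Finset (Orb Λ)) (Finset (Orb Λ)) ℂ := fun _ _ Λ _ _ e x => ∑ j : Fin 4, (((![1, 1, -1, -1] : Fin 4 → ℝ) j / Real.sqrt 2 : ℝ) : ℂ) • (annihilation (orb x 0) * annihilation (orb ((![e.symm ((e x).1 + 1, (e x).2), e.symm ((e x).1 - 1, (e x).2), e.symm ((e x).1, (e x).2 + 1), e.symm ((e x).1, (e x).2 - 1)] : Fin 4 → Λ) j) 1) - annihilation (orb x 1) * annihilation (orb ((![e.symm ((e x).1 + 1, (e x).2), e.symm ((e x).1 - 1, (e x).2), e.symm ((e x).1, (e x).2 + 1), e.symm ((e x).1, (e x).2 - 1)] : Fin 4 → Λ) j) 0)); let G : ∀ (L M : ℕ) [NeZero L] [NeZero M] (Λ : Type) [LinearOrder Λ] [Fintype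 Λ], (Λ ≃ ZMod L × ZMod M) → Fock (Orb Λ) → ZMod L → ℝ := fun L M _ _ Λ _ _ e ψ r => ∑ a : ZMod L, (expect ((∑ b : ZMod M, P L M Λ e (e.symm (a, b)))ᴴ * (∑ b : ZMod M, P L M Λ e (e.symm (a + r, b)))) ψ).re; ∀ (Λ : Type) [LinearOrder Λ] [Fintype Λ] (e : Λ ≃ ZMod L × ZMod M), g / (M : ℝ) ≤ (H0 L M Λ e U).minEnergyOn (szSector (Np L M δ) 1) - (H0 L M Λ e U).minEnergyOn (szSector (Np L M δ) 0)

/-- S⁺₂a — STIFF TUBES ARE SPIN-GAPPED: uniform thermodynamics forces a spin gap `≥ g/M` on all wide tubes. -/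
def StiffImpliesSpinGap : Prop :=
  ∀ U : ℝ, 0 < U → ∀ δ ∈ Set.Ioo (0 : ℝ) (3 / 10), ∀ (d₀ k₀ : ℝ) (M₁ L₀ : ℕ), 0 < d₀ →
    UniformThermo U δ d₀ k₀ M₁ L₀ →
      ∃ g : ℝ, 0 < g ∧ ∃ M₂ L₁ : ℕ, ∀ (L M : ℕ) [NeZero L] [NeZero M], Even L → Even M → M₂ ≤ M → M ≤ L → L₁ ≤ L → SpinGapLM U δ L M g

/-- S⁺₂b — LUTHER–EMERY UNIVERSALITY: spin-gapped, stiff, compressible tubes obey the Haldane-form law uniformly. -/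
def LutherEmeryUniversality : Prop :=
  ∀ U : ℝ, 0 < U → ∀ δ ∈ Set.Ioo (0 : ℝ) (3 / 10), ∀ (d₀ k₀ : ℝ) (M₁ L₀ : ℕ), 0 < d₀ →
    UniformThermo U δ d₀ k₀ M₁ L₀ →
      ∀ (g : ℝ) (M₂ L₁ : ℕ), 0 < g →
        (∀ (L M : ℕ) [NeZero L] [NeZero M], Even L → Even M → M₂ ≤ M → M ≤ L → L₁ ≤ L → SpinGapLM U δ L M g) →
          ∃ Ξ : ℝ, 0 < Ξ ∧ ∃ A : ℝ, 0 < A ∧ ∃ R M₃ L₂ : ℕ, ∀ M : ℕ, Even M → M₃ ≤ M → LawAt U δ M Ξ A R L₂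

theorem family_of_spinGap (h1 : StiffImpliesSpinGap) (h2 : LutherEmeryUniversality) : BridgeFamily := by
  intro U hU δ hδ d₀ k₀ M₁ L₀ hd₀ hth
  obtain ⟨g, hg, M₂, L₁, hgap⟩ := h1 U hU δ hδ d₀ k₀ M₁ L₀ hd₀ hth
  exact h2 U hU δ hδ d₀ k₀ M₁ L₀ hd₀ hth g M₂ L₁ hg hgap

theorem bridge_of_spinGap (h1 : StiffImpliesSpinGap) (h2 : LutherEmeryUniversality) : WidthHaldaneBridge :=
  bridge_of_family (family_of_spinGap h1 h2)

/-! ## NEGATION attempt: the obstruction one meets -/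

/-- Inverse pair compressibility FLOOR `k ≤ ẽ″_{L,M}` at one `(L, M)` (compressibility bounded above; NOT part of the
crux's hypothesis, which only gives `0 < ẽ″ ≤ k₀`). -/
def IcompFloorLM (U δ : ℝ) (L M : ℕ) [NeZero L] [NeZero M] (k : ℝ) : Prop :=
  open Matrix Literature.MathematicalPhysics.QuantumLattice in let H0 : ∀ (L M : ℕ) (Λ : Type) [LinearOrder Λ] [Fintype Λ], (Λ ≃ ZMod L × ZMod M) → ℝ → Matrix (Finset (Orb Λ)) (Finset (Orb Λ)) ℂ := fun _ _ Λ _ _ e U => hamiltonian (SimpleGraph.fromRel fun x y : Λ => y = e.symm ((e x).1 + 1, (e x).2) ∨ y = e.symm ((e x).1, (e x).2 + 1)) 1 U; let Tw : ∀ (L M : ℕ) [NeZero L] [NeZero M] (Λ : Type) [LinearOrder Λ] [Fintype Λ], (Λ ≃ ZMod L × ZMod M) → ℝ → Matrix (Finset (Orb Λ)) (Finset (Orb Λ)) ℂ := fun _ M _ _ _ _ _ e θ => ∑ b : ZMod M, ∑ σ : Fin 2, ((1 - Complex.exp (Complex.I * θ)) • (creation (orb (e.symm (0, b)) σ) * annihilation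 (orb (e.symm (-1, b)) σ)) + (1 - Complex.exp (-(Complex.I * θ))) • (creation (orb (e.symm (-1, b)) σ) * annihilation (orb (e.symm (0, b)) σ))); let E : ∀ (L M : ℕ) [NeZero L] [NeZero M] (Λ : Type) [LinearOrder Λ] [Fintype Λ], (Λ ≃ ZMod L × ZMod M) → ℝ → ℝ → ℕ → ℝ := fun L M _ _ Λ _ _ e U θ N => (H0 L M Λ e U + Tw L M Λ e θ).minEnergyOn (szSector N 0); let Np : ℕ → ℕ → ℝ → ℕ := fun L M δ => 2 * ⌊(1 - δ) * ((L : ℝ) * (M : ℝ)) / 2⌋₊; let stiff : ∀ (L M : ℕ) [NeZero L] [NeZero M] (Λ : Type) [LinearOrder Λ] [Fintype Λ], (Λ ≃ ZMod L × ZMod M) → ℝ → ℝ → ℝ := fun L M _ _ Λ _ _ e U δ => 2 * (L : ℝ) * (E L M Λ e U (Real.pi / 3) (Np L M δ) - E L M Λ e U 0 (Np L M δ)) / ((Real.pi / 3) ^ 2 * (M : ℝ)); let icomp : ∀ (L M : ℕ) [NeZero L] [NeZero M] (Λ : Type) [LinearOrder Λ] [Fintype Λ], (Λ ≃ ZMod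 L × ZMod M) → ℝ → ℝ → ℝ := fun L M _ _ Λ _ _ e U δ => (L : ℝ) * (M : ℝ) * (E L M Λ e U 0 (Np L M δ + 2) + E L M Λ e U 0 (Np L M δ - 2) - 2 * E L M Λ e U 0 (Np L M δ)) / 4; let P : ∀ (L M : ℕ) (Λ : Type) [LinearOrder Λ] [Fintype Λ], (Λ ≃ ZMod L × ZMod M) → Λ → Matrix (Finset (Orb Λ)) (Finset (Orb Λ)) ℂ := fun _ _ Λ _ _ e x => ∑ j : Fin 4, (((![1, 1, -1, -1] : Fin 4 → ℝ) j / Real.sqrt 2 : ℝ) : ℂ) • (annihilation (orb x 0) * annihilation (orb ((![e.symm ((e x).1 + 1, (e x).2), e.symm ((e x).1 - 1, (e x).2), e.symm ((e x).1, (e x).2 + 1), e.symm ((e x).1, (e x).2 - 1)] : Fin 4 → Λ) j) 1) - annihilation (orb x 1) * annihilation (orb ((![e.symm ((e x).1 + 1, (e x).2), e.symm ((e x).1 - 1, (e x).2), e.symm ((e x).1, (e x).2 + 1), e.symm ((e x).1, (e x).2 - 1)] : Fin 4 → Λ) j) 0)); let G : ∀ (L M : ℕ) [NeZero L] [NeZero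 M] (Λ : Type) [LinearOrder Λ] [Fintype Λ], (Λ ≃ ZMod L × ZMod M) → Fock (Orb Λ) → ZMod L → ℝ := fun L M _ _ Λ _ _ e ψ r => ∑ a : ZMod L, (expect ((∑ b : ZMod M, P L M Λ e (e.symm (a, b)))ᴴ * (∑ b : ZMod M, P L M Λ e (e.symm (a + r, b)))) ψ).re; ∀ (Λ : Type) [LinearOrder Λ] [Fintype Λ] (e : Λ ≃ ZMod L × ZMod M), k ≤ icomp L M Λ e U δ

/-- NEGATION OBSTRUCTION (Pitaevskii–Stringari 1991 / Koma–Tasaki-type tightness, `T = 0`, quasi-1D): at FIXED width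
`M`, under a compressibility ceiling, no sequence of sector ground states can obey the exponent-ZERO law `G ≥ A·L·M²`
(`LawAtLM … 0 A 1`: `r̂⁰ = 1`) for all large even `L` — so the crux's exponent `Ξ√(ẽ″/ρ̃)/M > 0` is forced, and a
counterexample must come from a too-LARGE true exponent, i.e. from identifying the phase of an interacting tube. Signature only. -/
def NoFixedWidthLRO : Prop :=
  ∀ U : ℝ, 0 < U → ∀ δ ∈ Set.Ioo (0 : ℝ) (3 / 10), ∀ (M : ℕ) [NeZero M] (k A : ℝ), 0 < k → 0 < A →
    (∀ (L : ℕ) [NeZero L], Even L → M ≤ L → IcompFloorLM U δ L M k) →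
      ¬ ∀ (L : ℕ) [NeZero L], Even L → M ≤ L → LawAtLM U δ L M 0 A 1

end Summit.HubbardSuperconductivity.HubbardSuperconductivity.Cruxes.WidthHaldaneBridge.Strategist
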